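import Mathlib
import HarnessLib
import Literature.MathematicalPhysics.QuantumLattice.GaugeGroups
import Literature.LinearAlgebra.Matrix.UnitaryGroupMaximalTorus
import Literature.LinearAlgebra.Matrix.SpecialUnitaryGroupConjugacyClasses
import Literature.RepresentationTheory.CompactGroups.WeylIntegralFormula
import Summits.Ventures.LatticeQCDFlow.Exactness.SpectralKernelJacobianWeylShapeSU
import Summits.Ventures.LatticeQCDFlow.Exactness.SpectralKernelJacobianWeylFact
import Summits.Ventures.LatticeQCDFlow.Exactness.SpectralCouplingLayerExactnessWeylFact
import Summits.Ventures.LatticeQCDFlow.Exactness.SU2TorusAlcoveJacobian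
import Summits.Ventures.LatticeQCDFlow.Exactness.WeylIntegralFormulaSU2

/-!
# The `SU(2)` spectral kernel and spectral coupling layer are exact transports of Haar with the booked density — unconditionally

HONEST FRAMING: exact (Metropolis-corrected) sampling algorithms for lattice gauge theory;
figures of merit are autocorrelation/cost numbers at stated couplings and volumes; no
continuum-physics claim.

Venture `LatticeQCDFlow` (cell pub-lqcd), topic `Exactness`; FANOUT row 10 (`eng-equiv`, engine
`latflow.equiv` `spectral.SUNSpectralCoupling` / `latflow.flows_jax.sun_flow` with `N = 2`: Boyda et
al., PRD 103 (2021) 074504, the `SU(2)` flows of §IV and App. B; the S0-C `SU(2)` preset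
`preset_boyda2021`).  NEW WORK of the cell — the ASSEMBLY, for `N = 2`, of
`SpectralKernelJacobianWeylFact.lean` / `SpectralCouplingLayerExactnessWeylFact.lean` (exactness
modulo Weyl's formula and the torus Jacobian) with this row's `WeylIntegralFormulaSU2.lean`
(**Weyl's formula for `SU(2)` proved**: `weylIntegralFormula_specialUnitary_fin_two`) and
`SU2TorusAlcoveJacobian.lean` (**the torus Jacobian from a monotone `C¹` alcove map**).  Nothing is
cited as a fact; no hypothesis names an unproved fact; no number; no definition.

## What is typed (`c : U(1) → SΔ(2)` the torus chart `z ↦ diag(z, z⁻¹)`, hypothesis `hc`;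
`exists_su2TorusChart`)

* `continuous_torusMap_of_continuousOn` (any `n`) — the torus map `fT` of an eigenvalue map `f`
  continuous on the unimodular torus is continuous (hence measurable);
* `torusMap_su2TorusChart_exp` — if `f (w, w⁻¹) = (w', w'⁻¹)` then `fT (c w) = c w'`;
* **`hasJacobian_spectralKernel_su2_of_alcoveMap`** — THE KERNEL: let `f` be continuous on the
  unimodular torus with, on the alcove, `f(e^{±ia}, e^{∓ia}) = (e^{±ig(a)}, e^{∓ig(a)})` for a
  measurable monotone `g : [0,π] → [0,π]` onto, with derivative `g'` within `[0,π]`; let `h` follow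
  the spectral recipe of `f`, `fT` be its torus map, `Jf` measurable with `Jf(c e^{±ia}) = g'(a)`,
  and `J` measurable with Boyda's identity `J(g t g⁻¹)·|Δ(t)|²/2 = Jf(t)·|Δ(fT t)|²/2`.  Then
  `HasJacobian (Haar SU(2)) h J` — NO further hypothesis;
* **`hasJacobian_spectralCouplingLayer_su2_of_alcoveMaps`** — THE LAYER: on `ι → SU(2)` with
  product Haar, mask `p`, frozen staples `S a y`, per-link eigenvalue maps `f a y` given on the
  alcove by monotone `g a y` (parameters from the frozen context), kernels `h a y`, booked
  densities `j a y ≥ 0` (jointly continuous) with Boyda's identity: the coupling layer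
  `Theory2.coupleFun p (u ↦ h a y (uS)(uS)⁻¹u)` has
  `HasJacobian (⊗ Haar_{SU(2)}) _ (ofReal ∘ Theory2.coupleJac p (j at the loops))` — the `SU(2)`
  spectral coupling layer AS SHIPPED is an exact transport of product Haar with exactly the
  log-det the engine accumulates, unconditionally.

NOT here: `N ≥ 3` (Weyl's formula and the simplex alcove chart remain the two named inputs there);
any number.
-/

noncomputable section

namespace Summit.Ventures.LatticeQCDFlow.Exactness

open MeasureTheory Matrix Topology Set Real
open Literature.LinearAlgebra.Matrix
open Literature.MathematicalPhysics.QuantumFieldTheory (haarProbability)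
open Literature.RepresentationTheory.CompactGroups
open scoped ENNReal

/-! ## The torus map of a continuous eigenvalue map is continuous (any `n`) -/

section General

variable {n : Type*} [Fintype n] [DecidableEq n]

/-- **The torus map is continuous**: if `f` is continuous on the unimodular torus and
`fT t = diag(f(t_11, …, t_nn))`, then `fT : SΔ(n) → SΔ(n)` is continuous. -/
theorem continuous_torusMap_of_continuousOn {f : (n → ℂ) → (n → ℂ)}
    (hfc : ContinuousOn f {d | ∀ i, ‖d i‖ = 1})
    {fT : specialDiagonalTorus n → specialDiagonalTorus n}
    (hfT : ∀ t : specialDiagonalTorus n, ((fT t : Matrix.specialUnitaryGroup n ℂ) : Matrix n n ℂ) =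
      diagonal (f fun i => ((t : Matrix.specialUnitaryGroup n ℂ) : Matrix n n ℂ) i i)) :
    Continuous fT := by
  refine continuous_induced_rng.2 (continuous_induced_rng.2 ?_)
  have hfun : (fun t => ((fT t : Matrix.specialUnitaryGroup n ℂ) : Matrix n n ℂ)) =
      fun t : specialDiagonalTorus n =>
        diagonal (f fun i => ((t : Matrix.specialUnitaryGroup n ℂ) : Matrix n n ℂ) i i) := funext hfT
  change Continuous fun t => ((fT t : Matrix.specialUnitaryGroup n ℂ) : Matrix n n ℂ)
  rw [hfun]
  have hentries : Continuous fun t : specialDiagonalTorus n =>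
      fun i => ((t : Matrix.specialUnitaryGroup n ℂ) : Matrix n n ℂ) i i :=
    continuous_pi fun i => (continuous_apply i).comp ((continuous_apply i).comp
      (continuous_subtype_val.comp continuous_subtype_val))
  have hmaps : MapsTo (fun t : specialDiagonalTorus n =>
      fun i => ((t : Matrix.specialUnitaryGroup n ℂ) : Matrix n n ℂ) i i) univ {d | ∀ i, ‖d i‖ = 1} :=
    fun t _ i => norm_specialDiagonalTorus_apply t i
  have h := hfc.comp_continuous hentries fun t => hmaps (mem_univ t)
  exact h.matrix_diagonal

/-- … hence measurable. -/
theorem measurable_torusMap_of_continuousOn {f : (n → ℂ) → (n → ℂ)}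
    (hfc : ContinuousOn f {d | ∀ i, ‖d i‖ = 1})
    {fT : specialDiagonalTorus n → specialDiagonalTorus n}
    (hfT : ∀ t : specialDiagonalTorus n, ((fT t : Matrix.specialUnitaryGroup n ℂ) : Matrix n n ℂ) =
      diagonal (f fun i => ((t : Matrix.specialUnitaryGroup n ℂ) : Matrix n n ℂ) i i)) :
    Measurable fT :=
  haveI : SecondCountableTopology (specialDiagonalTorus n) := secondCountableTopology_specialDiagonalTorus
  (continuous_torusMap_of_continuousOn hfc hfT).measurable

end General

/-! ## `SU(2)`: the torus map on the chart -/

section SU2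

variable {c : Circle → specialDiagonalTorus (Fin 2)}
  (hc : ∀ z, (((c z : specialDiagonalTorus (Fin 2)) : Matrix.specialUnitaryGroup (Fin 2) ℂ) :
    Matrix (Fin 2) (Fin 2) ℂ) = diagonal ![(z : ℂ), ((z⁻¹ : Circle) : ℂ)])

include hc

/-- The diagonal entries of `c w` are `(w, w⁻¹)`. -/
theorem su2TorusChart_entries (w : Circle) :
    (fun i => (((c w : specialDiagonalTorus (Fin 2)) : Matrix.specialUnitaryGroup (Fin 2) ℂ) :
      Matrix (Fin 2) (Fin 2) ℂ) i i) = ![(w : ℂ), ((w⁻¹ : Circle) : ℂ)] := by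
  funext i
  rw [hc, diagonal_apply_eq]

/-- **The torus map on the chart**: if `f (w, w⁻¹) = (w', w'⁻¹)` then `fT (c w) = c w'`. -/
theorem torusMap_su2TorusChart {f : (Fin 2 → ℂ) → (Fin 2 → ℂ)}
    {fT : specialDiagonalTorus (Fin 2) → specialDiagonalTorus (Fin 2)}
    (hfT : ∀ t : specialDiagonalTorus (Fin 2),
      ((fT t : Matrix.specialUnitaryGroup (Fin 2) ℂ) : Matrix (Fin 2) (Fin 2) ℂ) =
        diagonal (f fun i => ((t : Matrix.specialUnitaryGroup (Fin 2) ℂ) : Matrix (Fin 2) (Fin 2) ℂ) i i))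
    {w w' : Circle} (hf : f ![(w : ℂ), ((w⁻¹ : Circle) : ℂ)] = ![(w' : ℂ), ((w'⁻¹ : Circle) : ℂ)]) :
    fT (c w) = c w' := by
  apply Subtype.ext
  apply Subtype.ext
  rw [hfT, su2TorusChart_entries hc, hf, hc]

/-- **The `SU(2)` spectral kernel is an exact transport of Haar with the booked density —
unconditionally.**  Eigenvalue map `f` continuous on the unimodular torus and given on the Weyl
alcove by a measurable monotone `g : [0, π] → [0, π]` onto, with derivative `g'` (measurable) within
`[0, π]`: `f(e^{ia}, e^{−ia}) = (e^{ig(a)}, e^{−ig(a)})` and `f(e^{−ia}, e^{ia}) = (e^{−ig(a)}, e^{ig(a)})`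
(permutation equivariance); kernel `h` following the spectral recipe of `f`; torus map `fT`; torus
density `Jf` (measurable, `= g'(a)` on both chambers); booked density `J` (measurable) with Boyda's
identity.  Then `HasJacobian (Haar SU(2)) h J`.  Weyl's formula enters as the THEOREM
`weylIntegralFormula_specialUnitary_fin_two`, the torus Jacobian as
`hasJacobian_su2Torus_of_alcoveMap`. -/
theorem hasJacobian_spectralKernel_su2_of_alcoveMap
    {f : (Fin 2 → ℂ) → (Fin 2 → ℂ)} (hfc : ContinuousOn f {d | ∀ i, ‖d i‖ = 1})
    {g g' : ℝ → ℝ} (hg : Measurable g) (hg' : Measurable g')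
    (hderiv : ∀ a ∈ Icc 0 π, HasDerivWithinAt g (g' a) (Icc 0 π) a) (hmono : MonotoneOn g (Icc 0 π))
    (himage : g '' Icc 0 π = Icc 0 π)
    (hfpos : ∀ a ∈ Icc 0 π, f ![(Circle.exp a : ℂ), (((Circle.exp a)⁻¹ : Circle) : ℂ)] =
      ![(Circle.exp (g a) : ℂ), (((Circle.exp (g a))⁻¹ : Circle) : ℂ)])
    (hfneg : ∀ a ∈ Icc 0 π, f ![(Circle.exp (-a) : ℂ), (((Circle.exp (-a))⁻¹ : Circle) : ℂ)] =
      ![(Circle.exp (-(g a)) : ℂ), (((Circle.exp (-(g a)))⁻¹ : Circle) : ℂ)])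
    {h : Matrix.specialUnitaryGroup (Fin 2) ℂ → Matrix.specialUnitaryGroup (Fin 2) ℂ}
    (hagree : ∀ (P : Matrix.specialUnitaryGroup (Fin 2) ℂ) (V : Matrix (Fin 2) (Fin 2) ℂ) (d : Fin 2 → ℂ),
      V ∈ Matrix.unitaryGroup (Fin 2) ℂ → (P : Matrix (Fin 2) (Fin 2) ℂ) = V * diagonal d * star V →
        ((h P : Matrix.specialUnitaryGroup (Fin 2) ℂ) : Matrix (Fin 2) (Fin 2) ℂ) = V * diagonal (f d) * star V)
    {fT : specialDiagonalTorus (Fin 2) → specialDiagonalTorus (Fin 2)}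
    (hfT : ∀ t : specialDiagonalTorus (Fin 2),
      ((fT t : Matrix.specialUnitaryGroup (Fin 2) ℂ) : Matrix (Fin 2) (Fin 2) ℂ) =
        diagonal (f fun i => ((t : Matrix.specialUnitaryGroup (Fin 2) ℂ) : Matrix (Fin 2) (Fin 2) ℂ) i i))
    {Jf : specialDiagonalTorus (Fin 2) → ℝ≥0∞} (hJfm : Measurable Jf)
    (hJpos : ∀ a ∈ Icc 0 π, Jf (c (Circle.exp a)) = ENNReal.ofReal (g' a))
    (hJneg : ∀ a ∈ Icc 0 π, Jf (c (Circle.exp (-a))) = ENNReal.ofReal (g' a))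
    {J : Matrix.specialUnitaryGroup (Fin 2) ℂ → ℝ≥0∞} (hJm : Measurable J)
    (hJ : ∀ (k : Matrix.specialUnitaryGroup (Fin 2) ℂ) (t : specialDiagonalTorus (Fin 2)),
      J (k * (t : Matrix.specialUnitaryGroup (Fin 2) ℂ) * k⁻¹) * ENNReal.ofReal
          ((∏ i, ∏ j ∈ Finset.univ.erase i,
            ‖((t : Matrix.specialUnitaryGroup (Fin 2) ℂ) : Matrix (Fin 2) (Fin 2) ℂ) i i -
              ((t : Matrix.specialUnitaryGroup (Fin 2) ℂ) : Matrix (Fin 2) (Fin 2) ℂ) j j‖) /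
                (Fintype.card (Fin 2)).factorial) =
        Jf t * ENNReal.ofReal
          ((∏ i, ∏ j ∈ Finset.univ.erase i,
            ‖((fT t : Matrix.specialUnitaryGroup (Fin 2) ℂ) : Matrix (Fin 2) (Fin 2) ℂ) i i -
              ((fT t : Matrix.specialUnitaryGroup (Fin 2) ℂ) : Matrix (Fin 2) (Fin 2) ℂ) j j‖) /
                (Fintype.card (Fin 2)).factorial)) :
    HasJacobian (haarProbability (Matrix.specialUnitaryGroup (Fin 2) ℂ)) h J := by
  have hfTm : Measurable fT := measurable_torusMap_of_continuousOn hfc hfT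
  have hfJ : HasJacobian (haarProbability (specialDiagonalTorus (Fin 2))) fT Jf :=
    hasJacobian_su2Torus_of_alcoveMap hc hg hg' hderiv hmono himage hfTm hJfm
      (fun a ha => torusMap_su2TorusChart hc hfT (hfpos a ha))
      (fun a ha => torusMap_su2TorusChart hc hfT (hfneg a ha)) hJpos hJneg
  exact hasJacobian_spectralKernel_specialUnitaryGroup_of_weylFact weylIntegralFormula_specialUnitary_fin_two
    hfc hagree hfT hfJ hJm hJ

/-- **The `SU(2)` spectral coupling layer is an exact transport of product Haar with exactly the
booked density — unconditionally.**  Links `ι`, mask `p`; per active link `a` and frozen context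
`y`: a staple `S a y` (continuous in `y`), an eigenvalue map `f a y` (jointly continuous on
context × unimodular torus) given on the alcove by a measurable monotone `g a y : [0,π] → [0,π]`
onto with derivative `g' a y` within `[0,π]`, a kernel `h a y` following its recipe, its torus map
`fT a y` and torus density `JfT a y` (measurable, `= g' a y` on both chambers), and a booked density
`j a y ≥ 0` (jointly continuous) with Boyda's identity.  Then the coupling layer
`Theory2.coupleFun p (u ↦ h a y (u S)(u S)⁻¹ u)` has
`HasJacobian (⊗_ι Haar_{SU(2)}) _ (ofReal ∘ Theory2.coupleJac p (j at the loops))`. -/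
theorem hasJacobian_spectralCouplingLayer_su2_of_alcoveMaps {ι : Type*} [Fintype ι]
    (p : ι → Prop) [DecidablePred p]
    (S : {i // p i} → ({i // ¬p i} → Matrix.specialUnitaryGroup (Fin 2) ℂ) → Matrix.specialUnitaryGroup (Fin 2) ℂ)
    (hS : ∀ a, Continuous (S a))
    (f : {i // p i} → ({i // ¬p i} → Matrix.specialUnitaryGroup (Fin 2) ℂ) → (Fin 2 → ℂ) → (Fin 2 → ℂ))
    (hf : ∀ a, ContinuousOn
      (fun q : ({i // ¬p i} → Matrix.specialUnitaryGroup (Fin 2) ℂ) × (Fin 2 → ℂ) => f a q.1 q.2)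
      {q | ∀ i, ‖q.2 i‖ = 1})
    (g g' : {i // p i} → ({i // ¬p i} → Matrix.specialUnitaryGroup (Fin 2) ℂ) → ℝ → ℝ)
    (hg : ∀ a y, Measurable (g a y)) (hg' : ∀ a y, Measurable (g' a y))
    (hderiv : ∀ a y, ∀ x ∈ Icc 0 π, HasDerivWithinAt (g a y) (g' a y x) (Icc 0 π) x)
    (hmono : ∀ a y, MonotoneOn (g a y) (Icc 0 π)) (himage : ∀ a y, g a y '' Icc 0 π = Icc 0 π)
    (hfpos : ∀ a y, ∀ x ∈ Icc 0 π, f a y ![(Circle.exp x : ℂ), (((Circle.exp x)⁻¹ : Circle) : ℂ)] =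
      ![(Circle.exp (g a y x) : ℂ), (((Circle.exp (g a y x))⁻¹ : Circle) : ℂ)])
    (hfneg : ∀ a y, ∀ x ∈ Icc 0 π, f a y ![(Circle.exp (-x) : ℂ), (((Circle.exp (-x))⁻¹ : Circle) : ℂ)] =
      ![(Circle.exp (-(g a y x)) : ℂ), (((Circle.exp (-(g a y x)))⁻¹ : Circle) : ℂ)])
    (h : {i // p i} → ({i // ¬p i} → Matrix.specialUnitaryGroup (Fin 2) ℂ) →
      Matrix.specialUnitaryGroup (Fin 2) ℂ → Matrix.specialUnitaryGroup (Fin 2) ℂ)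
    (hagree : ∀ a y (P : Matrix.specialUnitaryGroup (Fin 2) ℂ) (V : Matrix (Fin 2) (Fin 2) ℂ) (d : Fin 2 → ℂ),
      V ∈ Matrix.unitaryGroup (Fin 2) ℂ → (P : Matrix (Fin 2) (Fin 2) ℂ) = V * diagonal d * star V →
        ((h a y P : Matrix.specialUnitaryGroup (Fin 2) ℂ) : Matrix (Fin 2) (Fin 2) ℂ) =
          V * diagonal (f a y d) * star V)
    (fT : {i // p i} → ({i // ¬p i} → Matrix.specialUnitaryGroup (Fin 2) ℂ) →
      specialDiagonalTorus (Fin 2) → specialDiagonalTorus (Fin 2))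
    (hfT : ∀ a y (t : specialDiagonalTorus (Fin 2)),
      ((fT a y t : Matrix.specialUnitaryGroup (Fin 2) ℂ) : Matrix (Fin 2) (Fin 2) ℂ) =
        diagonal (f a y fun i => ((t : Matrix.specialUnitaryGroup (Fin 2) ℂ) : Matrix (Fin 2) (Fin 2) ℂ) i i))
    (JfT : {i // p i} → ({i // ¬p i} → Matrix.specialUnitaryGroup (Fin 2) ℂ) →
      specialDiagonalTorus (Fin 2) → ℝ≥0∞)
    (hJfTm : ∀ a y, Measurable (JfT a y))
    (hJpos : ∀ a y, ∀ x ∈ Icc 0 π, JfT a y (c (Circle.exp x)) = ENNReal.ofReal (g' a y x))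
    (hJneg : ∀ a y, ∀ x ∈ Icc 0 π, JfT a y (c (Circle.exp (-x))) = ENNReal.ofReal (g' a y x))
    (j : {i // p i} → ({i // ¬p i} → Matrix.specialUnitaryGroup (Fin 2) ℂ) →
      Matrix.specialUnitaryGroup (Fin 2) ℂ → ℝ)
    (hjc : ∀ a, Continuous
      fun q : ({i // ¬p i} → Matrix.specialUnitaryGroup (Fin 2) ℂ) × Matrix.specialUnitaryGroup (Fin 2) ℂ =>
        j a q.1 q.2)
    (hj0 : ∀ a y u, 0 ≤ j a y u)
    (hJ : ∀ a y (k : Matrix.specialUnitaryGroup (Fin 2) ℂ) (t : specialDiagonalTorus (Fin 2)),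
      ENNReal.ofReal (j a y (k * (t : Matrix.specialUnitaryGroup (Fin 2) ℂ) * k⁻¹)) * ENNReal.ofReal
          ((∏ i, ∏ l ∈ Finset.univ.erase i,
            ‖((t : Matrix.specialUnitaryGroup (Fin 2) ℂ) : Matrix (Fin 2) (Fin 2) ℂ) i i -
              ((t : Matrix.specialUnitaryGroup (Fin 2) ℂ) : Matrix (Fin 2) (Fin 2) ℂ) l l‖) /
                (Fintype.card (Fin 2)).factorial) =
        JfT a y t * ENNReal.ofReal
          ((∏ i, ∏ l ∈ Finset.univ.erase i,
            ‖((fT a y t : Matrix.specialUnitaryGroup (Fin 2) ℂ) : Matrix (Fin 2) (Fin 2) ℂ) i i -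
              ((fT a y t : Matrix.specialUnitaryGroup (Fin 2) ℂ) : Matrix (Fin 2) (Fin 2) ℂ) l l‖) /
                (Fintype.card (Fin 2)).factorial)) :
    HasJacobian (Measure.pi fun _ : ι => haarProbability (Matrix.specialUnitaryGroup (Fin 2) ℂ))
      (Theory2.coupleFun p fun a y u => h a y (u * S a y) * (u * S a y)⁻¹ * u)
      fun U => ENNReal.ofReal (Theory2.coupleJac p (fun a y u => j a y (u * S a y)) U) := by
  -- each fibre's eigenvalue map is continuous on the unimodular torus
  have hfc : ∀ a y, ContinuousOn (f a y) {d | ∀ i, ‖d i‖ = 1} := by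
    intro a y
    have hslice : Continuous fun d : Fin 2 → ℂ => ((y, d) :
        ({i // ¬p i} → Matrix.specialUnitaryGroup (Fin 2) ℂ) × (Fin 2 → ℂ)) :=
      continuous_const.prodMk continuous_id
    exact (hf a).comp hslice.continuousOn fun d hd => hd
  have hfJ : ∀ a y, HasJacobian (haarProbability (specialDiagonalTorus (Fin 2))) (fT a y) (JfT a y) := by
    intro a y
    exact hasJacobian_su2Torus_of_alcoveMap hc (hg a y) (hg' a y) (hderiv a y) (hmono a y) (himage a y)
      (measurable_torusMap_of_continuousOn (hfc a y) (hfT a y)) (hJfTm a y)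
      (fun x hx => torusMap_su2TorusChart hc (hfT a y) (hfpos a y x hx))
      (fun x hx => torusMap_su2TorusChart hc (hfT a y) (hfneg a y x hx)) (hJpos a y) (hJneg a y)
  exact hasJacobian_spectralCouplingLayer_specialUnitary_of_weylFact weylIntegralFormula_specialUnitary_fin_two
    p S hS f hf h hagree fT hfT JfT hfJ j hjc hj0 hJ

end SU2

end Summit.Ventures.LatticeQCDFlow.Exactness
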